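import Summits.HodgeConjecture.HodgeConjecture.Theorems.Ring2WeilCoverageCyclotomicUnitSignatures
import HarnessLib

/-!
# Weil-type family coverage — THEOREM L (ii) IS KERNEL at levels `40, 48` (`g = 8`): the witness
# tables for the units `ζ^h(1 − ζ^a)(1 − ζ^b)`, every even sign pattern is a real unit's, and the census's YES rows
# `(40, K)`, `K = ℚ(i), ℚ(√−2), ℚ(√−5), ℚ(√−10)` and `(48, K)`, `K = ℚ(i), ℚ(√−2), ℚ(√−3), ℚ(√−6)` are UNCONDITIONAL

research route conditional on HC_CM; not a corollary; Q11.4-sentence-2 already refuted in dim ≥ 3.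

Ring 2, WEIL-TYPE FAMILY-COVERAGE CENSUS (`HOME/WEIL-FAMILY-COVERAGE.md` `## b01`, blocks b01.23 (A)/(C)/(D) and
b01.28 THEOREM F / THEOREM L, owner ring2-b01), part 16 of the `Ring2WeilCoverage*` series.  Part 13
(`…CyclotomicUnitProducts`) built, at every level, the real units `u(a,b,h) = ζ^h(1 − ζ^a)(1 − ζ^b)` with the
decidable sign predicate `negAt (a,b,h) t := (M < at mod 2M ↔ M < bt mod 2M)`; part 14
(`…CyclotomicUnitSignatures`) reduced THEOREM L (ii) «every even sign pattern on a CM type is a real unit's» and the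
census's YES verdicts to the finite WITNESS PROPERTY `(W)`: for each unit residue `s ∉ {±1}` a signed product of
admissible `u(x)` negative exactly at `{±1, ±s}`.  Here `(W)` is DISCHARGED at levels `40, 48`:

* `witnessTable_M` (`decide +kernel`): the explicit table `s ↦ (A_s, ε_s)` (found by linear algebra over `𝔽₂` on
  the sign vectors; generators with `a = 1`), checked on all unit residues; `witnessProperty_M`: `(W)`.
* **`exists_units_sign_eq_M` — THEOREM L (ii) at `M`**: for any `K` with `IsCyclotomicExtension {M} ℚ K`,
  `[IsCMField K]`, every CM type `Φ` and every `S ⊆ Φ` of even size, a unit of `𝓞 K` fixed by `ρ` is negative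
  exactly on `S` — by EXPLICIT cyclotomic units (no class number, no class field theory, no PARI).
* **`exists_principal_M_K` — the census's YES rows, UNCONDITIONAL**: for every CM type `Φ` balanced for the
  displayed `N_K` (`2|S_Φ ∩ N_K| = |S_Φ|`, the `K`-signature `(g/2, g/2)`; `n₋(M, K)` even by `decide`):
  `∃ ζ′ : K, ζ′^ρ = −ζ′ ∧ (∀ φ ∈ Φ, Im φ(ζ′) > 0) ∧ CMTypeLattice.IsOfType 1 ζ′ ⊤` — the principal CM torus
  `ℂ^Φ/Φ(ℤ[ζ_M])` CARRIES an `ι`-compatible principal polarisation.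

HONEST FRAMING: statements about Shimura's divisors `X_ζ′` of PRINCIPAL type on the principal CM torus
`ℂ^Φ/Φ(ℤ[ζ_M])` (`ι`-compatible principal polarisations) and about units of `𝓞 K`; the witness tables are checked
by `decide +kernel`; the sets `N_K` are displayed finite sets of residues (that they are «the residues acting as
complex conjugation on `K`», i.e. `χ_K(t) = −1`, is docstring-level, as in parts 9/10/12); nothing here is a
statement about Hodge classes, `W_K`, general members or HC; `HC_CM` is used nowhere.  No `def`, no named fact,
no `sorry`.

References: [cite: Shimura1998, §14.3 Prop. 4–5, pp. 103–104]; [cite: Washington1997, §8.1]; census b01.23 (A)–(D)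
/ b01.28 THEOREM F + THEOREM L (seat-derived).
-/

noncomputable section

open Polynomial NumberField Complex Finset
open scoped Real nonZeroDivisors

namespace Summit.HodgeConjecture.Ring2WeilCoverage.CyclotomicSignaturesG8A

open Literature.AlgebraicGeometry.Motives (CMType)
open Literature.AlgebraicGeometry.HodgeTheory (IsCMTypeSet)
open Literature.NumberTheory.ComplexMultiplication
open Summit.HodgeConjecture.Ring2WeilCoverage.CyclotomicUnitSignatures

variable {K : Type} [Field K] [NumberField K] {ζ : K}

section Level40

/-- `𝐞(t) = exp(2πi t/n) ∈ ℂ` (`ZMod.toCircle`). -/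
local notation3 (prettyPrint := false) "𝐞 " t:max => ((ZMod.toCircle t : Circle) : ℂ)

/-- the sign predicate of `u(x) = ζ^h(1 − ζ^a)(1 − ζ^b)`, `x = (a, b, h)`, at the unit residue `t` (part 13). -/
local notation3 (prettyPrint := false) "negAt " x:max t:max =>
  (40 < (x : ℕ × ℕ × ℕ).1 * ZMod.val t % (2 * 40) ↔ 40 < (x : ℕ × ℕ × ℕ).2.1 * ZMod.val t % (2 * 40))

/-- the sign pattern of the signed product `(A, ε)` at `t` (part 14). -/
local notation3 (prettyPrint := false) "pat " A:max ε:max t:max =>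
  Odd ((Finset.filter (fun x : ℕ × ℕ × ℕ => negAt x t) A).card + (if (ε : Bool) then 1 else 0))

/-- admissibility of a triple `x = (a, b, h)` (part 13). -/
local notation3 (prettyPrint := false) "Adm " x:max =>
  (¬ 40 ∣ (x : ℕ × ℕ × ℕ).1 ∧ ¬ 40 ∣ (x : ℕ × ℕ × ℕ).2.1 ∧
    (2 * (x : ℕ × ℕ × ℕ).2.2 + (x : ℕ × ℕ × ℕ).1 + (x : ℕ × ℕ × ℕ).2.1) % (2 * 40) = 0 ∧
    ¬ IsPrimePow (40 / Nat.gcd 40 (x : ℕ × ℕ × ℕ).1) ∧ ¬ IsPrimePow (40 / Nat.gcd 40 (x : ℕ × ℕ × ℕ).2.1))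

/-! ### Level `40` (`g = 8`; generators `(a,b,h)` = (1,3,38), (1,7,36), (1,9,35), (1,11,34), (1,13,33), (1,17,31)) -/

/-- **Witness table at level 40** (`decide`): for every unit residue `s ∉ {1, −1}` mod `40` the listed signed
product of admissible units `ζ^h(1 − ζ^a)(1 − ζ^b)` is negative exactly at the places `{±1, ±s}`.
research route conditional on HC_CM; not a corollary; Q11.4-sentence-2 already refuted in dim ≥ 3. [folklore] -/
theorem witnessTable_forty :
    ∀ s ∈ (Finset.univ.filter fun s : ZMod 40 => s.val.Coprime 40 ∧ s ≠ 1 ∧ s ≠ -1),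
      ∃ w ∈ ({
    (3, {(1, 3, 38), (1, 7, 36), (1, 9, 35), (1, 11, 34), (1, 13, 33)}, false),
    (7, {(1, 3, 38), (1, 13, 33), (1, 17, 31)}, false),
    (9, {(1, 7, 36), (1, 17, 31)}, true),
    (11, {(1, 3, 38), (1, 9, 35), (1, 17, 31)}, false),
    (13, {(1, 11, 34), (1, 17, 31)}, true),
    (17, {(1, 3, 38), (1, 9, 35), (1, 13, 33), (1, 17, 31)}, true),
    (19, {(1, 9, 35), (1, 13, 33), (1, 17, 31)}, false),
    (21, {(1, 9, 35), (1, 13, 33), (1, 17, 31)}, false),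
    (23, {(1, 3, 38), (1, 9, 35), (1, 13, 33), (1, 17, 31)}, true),
    (27, {(1, 11, 34), (1, 17, 31)}, true),
    (29, {(1, 3, 38), (1, 9, 35), (1, 17, 31)}, false),
    (31, {(1, 7, 36), (1, 17, 31)}, true),
    (33, {(1, 3, 38), (1, 13, 33), (1, 17, 31)}, false),
    (37, {(1, 3, 38), (1, 7, 36), (1, 9, 35), (1, 11, 34), (1, 13, 33)}, false)} :
      Finset (ZMod 40 × Finset (ℕ × ℕ × ℕ) × Bool)),
        w.1 = s ∧ (∀ x ∈ w.2.1, Adm x) ∧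
          ∀ t ∈ (Finset.univ.filter fun t : ZMod 40 => t.val.Coprime 40),
            (pat w.2.1 w.2.2 t ↔ (t = 1 ∨ t = -1 ∨ t = s ∨ t = -s)) := by
  decide +kernel

/-- **The witness property `(W)` of part 14 holds at level 40.**
research route conditional on HC_CM; not a corollary; Q11.4-sentence-2 already refuted in dim ≥ 3. [folklore] -/
theorem witnessProperty_forty :
    ∀ s : ZMod 40, s.val.Coprime 40 → s ≠ 1 → s ≠ -1 →
      ∃ A : Finset (ℕ × ℕ × ℕ), ∃ ε : Bool, (∀ x ∈ A, Adm x) ∧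
        ∀ t : ZMod 40, t.val.Coprime 40 → (pat A ε t ↔ (t = 1 ∨ t = -1 ∨ t = s ∨ t = -s)) := by
  intro s hs h1 h2
  obtain ⟨w, -, rfl, hA, hP⟩ :=
    witnessTable_forty s (Finset.mem_filter.mpr ⟨Finset.mem_univ _, hs, h1, h2⟩)
  exact ⟨w.2.1, w.2.2, hA, fun t ht => hP t (Finset.mem_filter.mpr ⟨Finset.mem_univ _, ht⟩)⟩

open scoped Classical in
/-- **THEOREM L (ii) AT LEVEL 40 — every even sign pattern on a CM type of `ℚ(ζ_40)` is a real unit's**: for any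
`K` with `IsCyclotomicExtension {40} ℚ K`, `[IsCMField K]`, every CM type `Φ` and every `S ⊆ Φ` with `|S|` even
there is a unit of `𝓞 K` fixed by `ρ`, negative (under `φ`) exactly for `φ ∈ S` («`Sig(E⁺)` ⊇ the even
hyperplane», by explicit cyclotomic units; no class number, no CFT).
research route conditional on HC_CM; not a corollary; Q11.4-sentence-2 already refuted in dim ≥ 3. [cite: Washington1997, §8.1] -/
theorem exists_units_sign_eq_forty [IsCMField K] [IsCyclotomicExtension {40} ℚ K] (hζ : IsPrimitiveRoot ζ 40)
    (Φ : CMType K) (S : Set (K →+* ℂ)) (hS : S ⊆ Φ.1) (hev : Even S.ncard) :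
    ∃ u : (𝓞 K)ˣ, IsCMField.complexConj K ((u : 𝓞 K) : K) = ((u : 𝓞 K) : K) ∧
      ∀ φ ∈ Φ.1, ((φ ((u : 𝓞 K) : K)).re < 0 ↔ φ ∈ S) :=
  exists_units_sign_eq hζ witnessProperty_forty Φ S hS hev


open scoped Classical in
/-- **CENSUS ROW `(ℚ(ζ_40), ℚ(i))` — UNCONDITIONAL YES: the principal CM torus `ℂ^Φ/Φ(ℤ[ζ_40])` CARRIES an
`ι`-compatible principal polarisation** for every CM type `Φ` of `ℚ(ζ_40)` balanced for
`N_K = {3, 7, 11, 19, 23, 27, 31, 39}` (the unit residues `t` with `χ_K(t) = −1`, `K = ℚ(i)`; `n₋ = 4` is even):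
`∃ ζ′, ζ′^ρ = −ζ′ ∧ (∀ φ ∈ Φ, Im φ(ζ′) > 0) ∧ CMTypeLattice.IsOfType 1 ζ′ ⊤` (parts 7/13/14 + the table).
research route conditional on HC_CM; not a corollary; Q11.4-sentence-2 already refuted in dim ≥ 3. [cite: Shimura1998, §14.3 Prop. 5, p. 104] -/
theorem exists_principal_forty_sqrt_neg_one [IsCMField K] [IsCyclotomicExtension {40} ℚ K]
    (hζ : IsPrimitiveRoot ζ 40) (Φ : CMType K)
    (hbal : 2 * ((Finset.univ.filter fun t : ZMod 40 => ∃ σ ∈ Φ.1, σ ζ = 𝐞 t) ∩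
        ({3, 7, 11, 19, 23, 27, 31, 39} : Finset (ZMod 40))).card =
      (Finset.univ.filter fun t : ZMod 40 => ∃ σ ∈ Φ.1, σ ζ = 𝐞 t).card) :
    ∃ ζ' : K, IsCMField.complexConj K ζ' = -ζ' ∧ (∀ φ : Φ.1, 0 < (φ.1 ζ').im) ∧
        CMTypeLattice.IsOfType (1 : (FractionalIdeal (𝓞 K)⁰ K)ˣ) ζ' ⊤ := by
  have hg : Nat.totient 40 = 2 * (7 + 1) := by decide
  have hNK : IsCMTypeSet 40 ({3, 7, 11, 19, 23, 27, 31, 39} : Finset (ZMod 40)) := by decide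
  have heven : Even (({3, 7, 11, 19, 23, 27, 31, 39} : Finset (ZMod 40)).filter fun t : ZMod 40 => 2 * t.val < 40).card := by
    decide
  exact exists_principal_of_witnesses hζ hg witnessProperty_forty Φ hNK hbal heven


open scoped Classical in
/-- **CENSUS ROW `(ℚ(ζ_40), ℚ(√−2))` — UNCONDITIONAL YES: the principal CM torus `ℂ^Φ/Φ(ℤ[ζ_40])` CARRIES an
`ι`-compatible principal polarisation** for every CM type `Φ` of `ℚ(ζ_40)` balanced for
`N_K = {7, 13, 21, 23, 29, 31, 37, 39}` (the unit residues `t` with `χ_K(t) = −1`, `K = ℚ(√−2)`; `n₋ = 2` is even):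
`∃ ζ′, ζ′^ρ = −ζ′ ∧ (∀ φ ∈ Φ, Im φ(ζ′) > 0) ∧ CMTypeLattice.IsOfType 1 ζ′ ⊤` (parts 7/13/14 + the table).
research route conditional on HC_CM; not a corollary; Q11.4-sentence-2 already refuted in dim ≥ 3. [cite: Shimura1998, §14.3 Prop. 5, p. 104] -/
theorem exists_principal_forty_sqrt_neg_two [IsCMField K] [IsCyclotomicExtension {40} ℚ K]
    (hζ : IsPrimitiveRoot ζ 40) (Φ : CMType K)
    (hbal : 2 * ((Finset.univ.filter fun t : ZMod 40 => ∃ σ ∈ Φ.1, σ ζ = 𝐞 t) ∩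
        ({7, 13, 21, 23, 29, 31, 37, 39} : Finset (ZMod 40))).card =
      (Finset.univ.filter fun t : ZMod 40 => ∃ σ ∈ Φ.1, σ ζ = 𝐞 t).card) :
    ∃ ζ' : K, IsCMField.complexConj K ζ' = -ζ' ∧ (∀ φ : Φ.1, 0 < (φ.1 ζ').im) ∧
        CMTypeLattice.IsOfType (1 : (FractionalIdeal (𝓞 K)⁰ K)ˣ) ζ' ⊤ := by
  have hg : Nat.totient 40 = 2 * (7 + 1) := by decide
  have hNK : IsCMTypeSet 40 ({7, 13, 21, 23, 29, 31, 37, 39} : Finset (ZMod 40)) := by decide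
  have heven : Even (({7, 13, 21, 23, 29, 31, 37, 39} : Finset (ZMod 40)).filter fun t : ZMod 40 => 2 * t.val < 40).card := by
    decide
  exact exists_principal_of_witnesses hζ hg witnessProperty_forty Φ hNK hbal heven


open scoped Classical in
/-- **CENSUS ROW `(ℚ(ζ_40), ℚ(√−5))` — UNCONDITIONAL YES: the principal CM torus `ℂ^Φ/Φ(ℤ[ζ_40])` CARRIES an
`ι`-compatible principal polarisation** for every CM type `Φ` of `ℚ(ζ_40)` balanced for
`N_K = {11, 13, 17, 19, 31, 33, 37, 39}` (the unit residues `t` with `χ_K(t) = −1`, `K = ℚ(√−5)`; `n₋ = 4` is even):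
`∃ ζ′, ζ′^ρ = −ζ′ ∧ (∀ φ ∈ Φ, Im φ(ζ′) > 0) ∧ CMTypeLattice.IsOfType 1 ζ′ ⊤` (parts 7/13/14 + the table).
research route conditional on HC_CM; not a corollary; Q11.4-sentence-2 already refuted in dim ≥ 3. [cite: Shimura1998, §14.3 Prop. 5, p. 104] -/
theorem exists_principal_forty_sqrt_neg_five [IsCMField K] [IsCyclotomicExtension {40} ℚ K]
    (hζ : IsPrimitiveRoot ζ 40) (Φ : CMType K)
    (hbal : 2 * ((Finset.univ.filter fun t : ZMod 40 => ∃ σ ∈ Φ.1, σ ζ = 𝐞 t) ∩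
        ({11, 13, 17, 19, 31, 33, 37, 39} : Finset (ZMod 40))).card =
      (Finset.univ.filter fun t : ZMod 40 => ∃ σ ∈ Φ.1, σ ζ = 𝐞 t).card) :
    ∃ ζ' : K, IsCMField.complexConj K ζ' = -ζ' ∧ (∀ φ : Φ.1, 0 < (φ.1 ζ').im) ∧
        CMTypeLattice.IsOfType (1 : (FractionalIdeal (𝓞 K)⁰ K)ˣ) ζ' ⊤ := by
  have hg : Nat.totient 40 = 2 * (7 + 1) := by decide
  have hNK : IsCMTypeSet 40 ({11, 13, 17, 19, 31, 33, 37, 39} : Finset (ZMod 40)) := by decide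
  have heven : Even (({11, 13, 17, 19, 31, 33, 37, 39} : Finset (ZMod 40)).filter fun t : ZMod 40 => 2 * t.val < 40).card := by
    decide
  exact exists_principal_of_witnesses hζ hg witnessProperty_forty Φ hNK hbal heven


open scoped Classical in
/-- **CENSUS ROW `(ℚ(ζ_40), ℚ(√−10))` — UNCONDITIONAL YES: the principal CM torus `ℂ^Φ/Φ(ℤ[ζ_40])` CARRIES an
`ι`-compatible principal polarisation** for every CM type `Φ` of `ℚ(ζ_40)` balanced for
`N_K = {3, 17, 21, 27, 29, 31, 33, 39}` (the unit residues `t` with `χ_K(t) = −1`, `K = ℚ(√−10)`; `n₋ = 2` is even):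
`∃ ζ′, ζ′^ρ = −ζ′ ∧ (∀ φ ∈ Φ, Im φ(ζ′) > 0) ∧ CMTypeLattice.IsOfType 1 ζ′ ⊤` (parts 7/13/14 + the table).
research route conditional on HC_CM; not a corollary; Q11.4-sentence-2 already refuted in dim ≥ 3. [cite: Shimura1998, §14.3 Prop. 5, p. 104] -/
theorem exists_principal_forty_sqrt_neg_ten [IsCMField K] [IsCyclotomicExtension {40} ℚ K]
    (hζ : IsPrimitiveRoot ζ 40) (Φ : CMType K)
    (hbal : 2 * ((Finset.univ.filter fun t : ZMod 40 => ∃ σ ∈ Φ.1, σ ζ = 𝐞 t) ∩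
        ({3, 17, 21, 27, 29, 31, 33, 39} : Finset (ZMod 40))).card =
      (Finset.univ.filter fun t : ZMod 40 => ∃ σ ∈ Φ.1, σ ζ = 𝐞 t).card) :
    ∃ ζ' : K, IsCMField.complexConj K ζ' = -ζ' ∧ (∀ φ : Φ.1, 0 < (φ.1 ζ').im) ∧
        CMTypeLattice.IsOfType (1 : (FractionalIdeal (𝓞 K)⁰ K)ˣ) ζ' ⊤ := by
  have hg : Nat.totient 40 = 2 * (7 + 1) := by decide
  have hNK : IsCMTypeSet 40 ({3, 17, 21, 27, 29, 31, 33, 39} : Finset (ZMod 40)) := by decide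
  have heven : Even (({3, 17, 21, 27, 29, 31, 33, 39} : Finset (ZMod 40)).filter fun t : ZMod 40 => 2 * t.val < 40).card := by
    decide
  exact exists_principal_of_witnesses hζ hg witnessProperty_forty Φ hNK hbal heven

end Level40


section Level48

/-- `𝐞(t) = exp(2πi t/n) ∈ ℂ` (`ZMod.toCircle`). -/
local notation3 (prettyPrint := false) "𝐞 " t:max => ((ZMod.toCircle t : Circle) : ℂ)

/-- the sign predicate of `u(x) = ζ^h(1 − ζ^a)(1 − ζ^b)`, `x = (a, b, h)`, at the unit residue `t` (part 13). -/
local notation3 (prettyPrint := false) "negAt " x:max t:max =>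
  (48 < (x : ℕ × ℕ × ℕ).1 * ZMod.val t % (2 * 48) ↔ 48 < (x : ℕ × ℕ × ℕ).2.1 * ZMod.val t % (2 * 48))

/-- the sign pattern of the signed product `(A, ε)` at `t` (part 14). -/
local notation3 (prettyPrint := false) "pat " A:max ε:max t:max =>
  Odd ((Finset.filter (fun x : ℕ × ℕ × ℕ => negAt x t) A).card + (if (ε : Bool) then 1 else 0))

/-- admissibility of a triple `x = (a, b, h)` (part 13). -/
local notation3 (prettyPrint := false) "Adm " x:max =>
  (¬ 48 ∣ (x : ℕ × ℕ × ℕ).1 ∧ ¬ 48 ∣ (x : ℕ × ℕ × ℕ).2.1 ∧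
    (2 * (x : ℕ × ℕ × ℕ).2.2 + (x : ℕ × ℕ × ℕ).1 + (x : ℕ × ℕ × ℕ).2.1) % (2 * 48) = 0 ∧
    ¬ IsPrimePow (48 / Nat.gcd 48 (x : ℕ × ℕ × ℕ).1) ∧ ¬ IsPrimePow (48 / Nat.gcd 48 (x : ℕ × ℕ × ℕ).2.1))

/-! ### Level `48` (`g = 8`; generators `(a,b,h)` = (1,5,45), (1,7,44), (1,11,42), (1,13,41), (1,17,39), (1,19,38)) -/

/-- **Witness table at level 48** (`decide`): for every unit residue `s ∉ {1, −1}` mod `48` the listed signed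
product of admissible units `ζ^h(1 − ζ^a)(1 − ζ^b)` is negative exactly at the places `{±1, ±s}`.
research route conditional on HC_CM; not a corollary; Q11.4-sentence-2 already refuted in dim ≥ 3. [folklore] -/
theorem witnessTable_fortyEight :
    ∀ s ∈ (Finset.univ.filter fun s : ZMod 48 => s.val.Coprime 48 ∧ s ≠ 1 ∧ s ≠ -1),
      ∃ w ∈ ({
    (5, {(1, 5, 45), (1, 13, 41), (1, 19, 38)}, false),
    (7, {(1, 11, 42), (1, 13, 41), (1, 17, 39)}, false),
    (11, {(1, 5, 45), (1, 13, 41), (1, 17, 39), (1, 19, 38)}, true),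
    (13, {(1, 5, 45), (1, 7, 44), (1, 17, 39)}, false),
    (17, {(1, 5, 45), (1, 11, 42)}, true),
    (19, {(1, 7, 44), (1, 11, 42), (1, 13, 41), (1, 19, 38)}, true),
    (23, {(1, 11, 42), (1, 17, 39), (1, 19, 38)}, false),
    (25, {(1, 11, 42), (1, 17, 39), (1, 19, 38)}, false),
    (29, {(1, 7, 44), (1, 11, 42), (1, 13, 41), (1, 19, 38)}, true),
    (31, {(1, 5, 45), (1, 11, 42)}, true),
    (35, {(1, 5, 45), (1, 7, 44), (1, 17, 39)}, false),
    (37, {(1, 5, 45), (1, 13, 41), (1, 17, 39), (1, 19, 38)}, true),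
    (41, {(1, 11, 42), (1, 13, 41), (1, 17, 39)}, false),
    (43, {(1, 5, 45), (1, 13, 41), (1, 19, 38)}, false)} :
      Finset (ZMod 48 × Finset (ℕ × ℕ × ℕ) × Bool)),
        w.1 = s ∧ (∀ x ∈ w.2.1, Adm x) ∧
          ∀ t ∈ (Finset.univ.filter fun t : ZMod 48 => t.val.Coprime 48),
            (pat w.2.1 w.2.2 t ↔ (t = 1 ∨ t = -1 ∨ t = s ∨ t = -s)) := by
  decide +kernel

/-- **The witness property `(W)` of part 14 holds at level 48.**
research route conditional on HC_CM; not a corollary; Q11.4-sentence-2 already refuted in dim ≥ 3. [folklore] -/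
theorem witnessProperty_fortyEight :
    ∀ s : ZMod 48, s.val.Coprime 48 → s ≠ 1 → s ≠ -1 →
      ∃ A : Finset (ℕ × ℕ × ℕ), ∃ ε : Bool, (∀ x ∈ A, Adm x) ∧
        ∀ t : ZMod 48, t.val.Coprime 48 → (pat A ε t ↔ (t = 1 ∨ t = -1 ∨ t = s ∨ t = -s)) := by
  intro s hs h1 h2
  obtain ⟨w, -, rfl, hA, hP⟩ :=
    witnessTable_fortyEight s (Finset.mem_filter.mpr ⟨Finset.mem_univ _, hs, h1, h2⟩)
  exact ⟨w.2.1, w.2.2, hA, fun t ht => hP t (Finset.mem_filter.mpr ⟨Finset.mem_univ _, ht⟩)⟩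

open scoped Classical in
/-- **THEOREM L (ii) AT LEVEL 48 — every even sign pattern on a CM type of `ℚ(ζ_48)` is a real unit's**: for any
`K` with `IsCyclotomicExtension {48} ℚ K`, `[IsCMField K]`, every CM type `Φ` and every `S ⊆ Φ` with `|S|` even
there is a unit of `𝓞 K` fixed by `ρ`, negative (under `φ`) exactly for `φ ∈ S` («`Sig(E⁺)` ⊇ the even
hyperplane», by explicit cyclotomic units; no class number, no CFT).
research route conditional on HC_CM; not a corollary; Q11.4-sentence-2 already refuted in dim ≥ 3. [cite: Washington1997, §8.1] -/
theorem exists_units_sign_eq_fortyEight [IsCMField K] [IsCyclotomicExtension {48} ℚ K] (hζ : IsPrimitiveRoot ζ 48)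
    (Φ : CMType K) (S : Set (K →+* ℂ)) (hS : S ⊆ Φ.1) (hev : Even S.ncard) :
    ∃ u : (𝓞 K)ˣ, IsCMField.complexConj K ((u : 𝓞 K) : K) = ((u : 𝓞 K) : K) ∧
      ∀ φ ∈ Φ.1, ((φ ((u : 𝓞 K) : K)).re < 0 ↔ φ ∈ S) :=
  exists_units_sign_eq hζ witnessProperty_fortyEight Φ S hS hev


open scoped Classical in
/-- **CENSUS ROW `(ℚ(ζ_48), ℚ(i))` — UNCONDITIONAL YES: the principal CM torus `ℂ^Φ/Φ(ℤ[ζ_48])` CARRIES an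
`ι`-compatible principal polarisation** for every CM type `Φ` of `ℚ(ζ_48)` balanced for
`N_K = {7, 11, 19, 23, 31, 35, 43, 47}` (the unit residues `t` with `χ_K(t) = −1`, `K = ℚ(i)`; `n₋ = 4` is even):
`∃ ζ′, ζ′^ρ = −ζ′ ∧ (∀ φ ∈ Φ, Im φ(ζ′) > 0) ∧ CMTypeLattice.IsOfType 1 ζ′ ⊤` (parts 7/13/14 + the table).
research route conditional on HC_CM; not a corollary; Q11.4-sentence-2 already refuted in dim ≥ 3. [cite: Shimura1998, §14.3 Prop. 5, p. 104] -/
theorem exists_principal_fortyEight_sqrt_neg_one [IsCMField K] [IsCyclotomicExtension {48} ℚ K]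
    (hζ : IsPrimitiveRoot ζ 48) (Φ : CMType K)
    (hbal : 2 * ((Finset.univ.filter fun t : ZMod 48 => ∃ σ ∈ Φ.1, σ ζ = 𝐞 t) ∩
        ({7, 11, 19, 23, 31, 35, 43, 47} : Finset (ZMod 48))).card =
      (Finset.univ.filter fun t : ZMod 48 => ∃ σ ∈ Φ.1, σ ζ = 𝐞 t).card) :
    ∃ ζ' : K, IsCMField.complexConj K ζ' = -ζ' ∧ (∀ φ : Φ.1, 0 < (φ.1 ζ').im) ∧
        CMTypeLattice.IsOfType (1 : (FractionalIdeal (𝓞 K)⁰ K)ˣ) ζ' ⊤ := by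
  have hg : Nat.totient 48 = 2 * (7 + 1) := by decide
  have hNK : IsCMTypeSet 48 ({7, 11, 19, 23, 31, 35, 43, 47} : Finset (ZMod 48)) := by decide
  have heven : Even (({7, 11, 19, 23, 31, 35, 43, 47} : Finset (ZMod 48)).filter fun t : ZMod 48 => 2 * t.val < 48).card := by
    decide
  exact exists_principal_of_witnesses hζ hg witnessProperty_fortyEight Φ hNK hbal heven


open scoped Classical in
/-- **CENSUS ROW `(ℚ(ζ_48), ℚ(√−2))` — UNCONDITIONAL YES: the principal CM torus `ℂ^Φ/Φ(ℤ[ζ_48])` CARRIES an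
`ι`-compatible principal polarisation** for every CM type `Φ` of `ℚ(ζ_48)` balanced for
`N_K = {5, 7, 13, 23, 29, 31, 37, 47}` (the unit residues `t` with `χ_K(t) = −1`, `K = ℚ(√−2)`; `n₋ = 4` is even):
`∃ ζ′, ζ′^ρ = −ζ′ ∧ (∀ φ ∈ Φ, Im φ(ζ′) > 0) ∧ CMTypeLattice.IsOfType 1 ζ′ ⊤` (parts 7/13/14 + the table).
research route conditional on HC_CM; not a corollary; Q11.4-sentence-2 already refuted in dim ≥ 3. [cite: Shimura1998, §14.3 Prop. 5, p. 104] -/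
theorem exists_principal_fortyEight_sqrt_neg_two [IsCMField K] [IsCyclotomicExtension {48} ℚ K]
    (hζ : IsPrimitiveRoot ζ 48) (Φ : CMType K)
    (hbal : 2 * ((Finset.univ.filter fun t : ZMod 48 => ∃ σ ∈ Φ.1, σ ζ = 𝐞 t) ∩
        ({5, 7, 13, 23, 29, 31, 37, 47} : Finset (ZMod 48))).card =
      (Finset.univ.filter fun t : ZMod 48 => ∃ σ ∈ Φ.1, σ ζ = 𝐞 t).card) :
    ∃ ζ' : K, IsCMField.complexConj K ζ' = -ζ' ∧ (∀ φ : Φ.1, 0 < (φ.1 ζ').im) ∧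
        CMTypeLattice.IsOfType (1 : (FractionalIdeal (𝓞 K)⁰ K)ˣ) ζ' ⊤ := by
  have hg : Nat.totient 48 = 2 * (7 + 1) := by decide
  have hNK : IsCMTypeSet 48 ({5, 7, 13, 23, 29, 31, 37, 47} : Finset (ZMod 48)) := by decide
  have heven : Even (({5, 7, 13, 23, 29, 31, 37, 47} : Finset (ZMod 48)).filter fun t : ZMod 48 => 2 * t.val < 48).card := by
    decide
  exact exists_principal_of_witnesses hζ hg witnessProperty_fortyEight Φ hNK hbal heven


open scoped Classical in
/-- **CENSUS ROW `(ℚ(ζ_48), ℚ(√−3))` — UNCONDITIONAL YES: the principal CM torus `ℂ^Φ/Φ(ℤ[ζ_48])` CARRIES an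
`ι`-compatible principal polarisation** for every CM type `Φ` of `ℚ(ζ_48)` balanced for
`N_K = {5, 11, 17, 23, 29, 35, 41, 47}` (the unit residues `t` with `χ_K(t) = −1`, `K = ℚ(√−3)`; `n₋ = 4` is even):
`∃ ζ′, ζ′^ρ = −ζ′ ∧ (∀ φ ∈ Φ, Im φ(ζ′) > 0) ∧ CMTypeLattice.IsOfType 1 ζ′ ⊤` (parts 7/13/14 + the table).
research route conditional on HC_CM; not a corollary; Q11.4-sentence-2 already refuted in dim ≥ 3. [cite: Shimura1998, §14.3 Prop. 5, p. 104] -/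
theorem exists_principal_fortyEight_sqrt_neg_three [IsCMField K] [IsCyclotomicExtension {48} ℚ K]
    (hζ : IsPrimitiveRoot ζ 48) (Φ : CMType K)
    (hbal : 2 * ((Finset.univ.filter fun t : ZMod 48 => ∃ σ ∈ Φ.1, σ ζ = 𝐞 t) ∩
        ({5, 11, 17, 23, 29, 35, 41, 47} : Finset (ZMod 48))).card =
      (Finset.univ.filter fun t : ZMod 48 => ∃ σ ∈ Φ.1, σ ζ = 𝐞 t).card) :
    ∃ ζ' : K, IsCMField.complexConj K ζ' = -ζ' ∧ (∀ φ : Φ.1, 0 < (φ.1 ζ').im) ∧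
        CMTypeLattice.IsOfType (1 : (FractionalIdeal (𝓞 K)⁰ K)ˣ) ζ' ⊤ := by
  have hg : Nat.totient 48 = 2 * (7 + 1) := by decide
  have hNK : IsCMTypeSet 48 ({5, 11, 17, 23, 29, 35, 41, 47} : Finset (ZMod 48)) := by decide
  have heven : Even (({5, 11, 17, 23, 29, 35, 41, 47} : Finset (ZMod 48)).filter fun t : ZMod 48 => 2 * t.val < 48).card := by
    decide
  exact exists_principal_of_witnesses hζ hg witnessProperty_fortyEight Φ hNK hbal heven


open scoped Classical in
/-- **CENSUS ROW `(ℚ(ζ_48), ℚ(√−6))` — UNCONDITIONAL YES: the principal CM torus `ℂ^Φ/Φ(ℤ[ζ_48])` CARRIES an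
`ι`-compatible principal polarisation** for every CM type `Φ` of `ℚ(ζ_48)` balanced for
`N_K = {13, 17, 19, 23, 37, 41, 43, 47}` (the unit residues `t` with `χ_K(t) = −1`, `K = ℚ(√−6)`; `n₋ = 4` is even):
`∃ ζ′, ζ′^ρ = −ζ′ ∧ (∀ φ ∈ Φ, Im φ(ζ′) > 0) ∧ CMTypeLattice.IsOfType 1 ζ′ ⊤` (parts 7/13/14 + the table).
research route conditional on HC_CM; not a corollary; Q11.4-sentence-2 already refuted in dim ≥ 3. [cite: Shimura1998, §14.3 Prop. 5, p. 104] -/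
theorem exists_principal_fortyEight_sqrt_neg_six [IsCMField K] [IsCyclotomicExtension {48} ℚ K]
    (hζ : IsPrimitiveRoot ζ 48) (Φ : CMType K)
    (hbal : 2 * ((Finset.univ.filter fun t : ZMod 48 => ∃ σ ∈ Φ.1, σ ζ = 𝐞 t) ∩
        ({13, 17, 19, 23, 37, 41, 43, 47} : Finset (ZMod 48))).card =
      (Finset.univ.filter fun t : ZMod 48 => ∃ σ ∈ Φ.1, σ ζ = 𝐞 t).card) :
    ∃ ζ' : K, IsCMField.complexConj K ζ' = -ζ' ∧ (∀ φ : Φ.1, 0 < (φ.1 ζ').im) ∧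
        CMTypeLattice.IsOfType (1 : (FractionalIdeal (𝓞 K)⁰ K)ˣ) ζ' ⊤ := by
  have hg : Nat.totient 48 = 2 * (7 + 1) := by decide
  have hNK : IsCMTypeSet 48 ({13, 17, 19, 23, 37, 41, 43, 47} : Finset (ZMod 48)) := by decide
  have heven : Even (({13, 17, 19, 23, 37, 41, 43, 47} : Finset (ZMod 48)).filter fun t : ZMod 48 => 2 * t.val < 48).card := by
    decide
  exact exists_principal_of_witnesses hζ hg witnessProperty_fortyEight Φ hNK hbal heven

end Level48

end Summit.HodgeConjecture.Ring2WeilCoverage.CyclotomicSignaturesG8A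

end
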